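import Literature.AlgebraicGeometry.ComplexMultiplication.BlockDimensionIdentityOfTateComparison
import HarnessLib

/-!
# The dual `ℓ`-adic comparison as a base change `(ℚ^ι)^∨ → ℚ̄_ℓ ⊗ (V_ℓ B)^∨` intertwining the transposed actions

Topic `Literature/AlgebraicGeometry/ComplexMultiplication`; namespace `Literature.AlgebraicGeometry.ComplexMultiplication`.  THEOREMS ONLY
(no definition, no named fact, no instance, no `sorry`); sequel of ★ `BlockDimensionIdentityOfTateComparison` (whose §1 builds this map
inside a proof) — exported BY NAME for the (MO) producer of the d6 S2′ degree road (A-p05 (g12) (F3), A-p02 (g14) (F2′): the `ℚ`-form on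
which `Aut(ℚ̄_ℓ/ℚ)` acts by `θ ⊗ 1`).  Cell `hodgecm-mathlib` (D-0151), crux `HLiu418` = stmt-HodgeConjecture-24832; count-neutral capital.

MATHEMATICS.  [Lang1982AbelianFunctions, Ch. VII §2 Thm. 2.1 p. 116] / [MumfordAV1970, §19 Thm. 3]: the `ℓ`-adic representation of `End⁰(B)` is
the extension of scalars of the rational one; in the tree this is the (D2) package `(ψ, c, hc)` of ★ `RationalRepresentationTateComparison`
(`c : ℚ_ℓ^ι ≃ V_ℓ B`, `c ∘ (ψ x)_{ℚ_ℓ} = V_ℓ(x) ∘ c`).  Dualising and extending scalars to `ℚ̄_ℓ` [BourbakiAlgebraI1989, Ch. II §5 no. 1 Prop. 4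
(p0379), no. 4 (p0383)]:
* `exists_isBaseChange_dualTateComparison` — there is a `ℚ`-linear `j₀ : (ℚ^ι)^∨ → ℚ̄_ℓ ⊗_{ℚ_ℓ} (V_ℓ B)^∨` which is a BASE CHANGE to `ℚ̄_ℓ`
  (Mathlib `IsBaseChange`; so `ℚ̄_ℓ ⊗_ℚ (ℚ^ι)^∨ ≃ ℚ̄_ℓ ⊗ (V_ℓ B)^∨` by `IsBaseChange.equiv`) and INTERTWINES `ᵗ(ψ x)` with `(ᵗV_ℓ(x)) ⊗ 1` for every
  `x ∈ End⁰(B)` (`j₀ := (1 ⊗ ·) ∘ (ᵗc)⁻¹ ∘ (IsBaseChange.toDual of the coordinates ℚ^ι → ℚ_ℓ^ι)`; Mathlib `IsBaseChange.finitePow/.dual/.comp`,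
  `TensorProduct.isBaseChange`, `RingHom.map_mulVec`).
* `exists_isBaseChange_dualTateComparison_block` — the same for the `ε`-blocks `range ᵗ(ψ ε)` and `range ((ᵗV_ℓ ε) ⊗ 1)` in any injective
  models (★ `DimensionIdentityTransport.exists_isBaseChange_block`).
HC_CM is proved only modulo the 7 printed citations until rung 0 closes; nothing of [Liu2021] is discharged here.

## References
* [Lang1982AbelianFunctions] S. Lang, *Introduction to Algebraic and Abelian Functions*, 2nd ed. (1982), Ch. VII §2, Thm. 2.1 (p. 116).
* [MumfordAV1970] D. Mumford, *Abelian Varieties* (1970), §19 Thm. 3 (p. 176).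
* [BourbakiAlgebraI1989] N. Bourbaki, *Algebra I*, Ch. II §5 no. 1 Prop. 4 (p0379), no. 4 (p0383).
-/

set_option autoImplicit false

open Module Function
open scoped TensorProduct
open Literature.AlgebraicGeometry.Motives
open Literature.AlgebraicGeometry.Motives.AbelianVariety (rationalTateAction)
open Literature.LinearAlgebra.BaseChange

namespace Literature.AlgebraicGeometry.ComplexMultiplication

universe u

variable {E : Type} [Field E] (B : AbelianVariety E) (ℓ : ℕ) [Fact ℓ.Prime]

/-- **The dual `ℓ`-adic comparison is a base change intertwining the transposed actions.**  For a rational representation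
`ψ : End⁰(B) → M_ι(ℚ)` with an `ℓ`-adic comparison `c : ℚ_ℓ^ι ≃ V_ℓ B` (`c ∘ (ψ x)_{ℚ_ℓ} = V_ℓ(x) ∘ c`), there is a `ℚ`-linear
`j₀ : (ℚ^ι)^∨ → ℚ̄_ℓ ⊗_{ℚ_ℓ} (V_ℓ B)^∨` with `IsBaseChange ℚ̄_ℓ j₀` and `((ᵗV_ℓ x) ⊗ 1) ∘ j₀ = j₀ ∘ ᵗ(ψ x)` for all `x`.
[cite: Lang1982AbelianFunctions, Ch. VII §2, Thm. 2.1, p. 116] [cite: BourbakiAlgebraI1989, Ch. II §5 no. 1 Proposition 4 (p0379) and no. 4 (p0383)] -/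
theorem exists_isBaseChange_dualTateComparison {ι : Type} [Fintype ι] [DecidableEq ι]
    (ψ : B.endAlgebra →ₐ[ℚ] Matrix ι ι ℚ) (c : (ι → ℚ_[ℓ]) ≃ₗ[ℚ_[ℓ]] B.rationalTateModule ℓ)
    (hc : ∀ x : B.endAlgebra,
      (c : (ι → ℚ_[ℓ]) →ₗ[ℚ_[ℓ]] B.rationalTateModule ℓ) ∘ₗ Matrix.mulVecLin ((ψ x).map (algebraMap ℚ ℚ_[ℓ])) =
        (rationalTateAction B ℓ x : Module.End ℚ_[ℓ] (B.rationalTateModule ℓ)) ∘ₗ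
          (c : (ι → ℚ_[ℓ]) →ₗ[ℚ_[ℓ]] B.rationalTateModule ℓ)) :
    ∃ j₀ : Module.Dual ℚ (ι → ℚ) →ₗ[ℚ] AlgebraicClosure ℚ_[ℓ] ⊗[ℚ_[ℓ]] Module.Dual ℚ_[ℓ] (B.rationalTateModule ℓ),
      IsBaseChange (AlgebraicClosure ℚ_[ℓ]) j₀ ∧
      ∀ (x : B.endAlgebra) (φ : Module.Dual ℚ (ι → ℚ)),
        (((rationalTateAction B ℓ x : Module.End ℚ_[ℓ] (B.rationalTateModule ℓ)).dualMap).baseChange (AlgebraicClosure ℚ_[ℓ])) (j₀ φ) =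
          j₀ ((Matrix.mulVecLin (ψ x)).dualMap φ) := by
  set L := AlgebraicClosure ℚ_[ℓ] with hL
  -- (1) coordinates `ℚ^ι → ℚ_ℓ^ι` are a base change, and so is their dual `(ℚ^ι)^∨ → (ℚ_ℓ^ι)^∨`
  have hb0 : IsBaseChange ℚ_[ℓ] ((Algebra.linearMap ℚ ℚ_[ℓ]).compLeft ι) := (IsBaseChange.linearMap ℚ ℚ_[ℓ]).finitePow ι
  have hd0 : IsBaseChange ℚ_[ℓ] hb0.toDual := hb0.dual
  have hd0x : ∀ (x : B.endAlgebra) (φ : Module.Dual ℚ (ι → ℚ)),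
      hb0.toDual ((Matrix.mulVecLin (ψ x)).dualMap φ) =
        (Matrix.mulVecLin ((ψ x).map (algebraMap ℚ ℚ_[ℓ]))).dualMap (hb0.toDual φ) :=
    fun x φ => toDual_dualMap_apply hb0 _ _ (fun v => mulVecLin_map_compLeft ℓ (ψ x) v) φ
  -- (2) `j₁ := (ᵗc)⁻¹ ∘ d₀ : (ℚ^ι)^∨ → (V_ℓ B)^∨`, a base change to `ℚ_ℓ`
  set j₁ : Module.Dual ℚ (ι → ℚ) →ₗ[ℚ] Module.Dual ℚ_[ℓ] (B.rationalTateModule ℓ) :=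
    (c.dualMap.symm.toLinearMap.restrictScalars ℚ) ∘ₗ hb0.toDual with hj₁def
  have hj₁ : IsBaseChange ℚ_[ℓ] j₁ := hd0.comp (IsBaseChange.ofEquiv c.dualMap.symm)
  have hj₁_apply : ∀ (φ : Module.Dual ℚ (ι → ℚ)) (y : B.rationalTateModule ℓ), j₁ φ y = hb0.toDual φ (c.symm y) := by
    intro φ y
    change (c.dualMap.symm (hb0.toDual φ)) y = _
    rw [LinearEquiv.dualMap_symm, LinearEquiv.dualMap_apply]
  have hc' : ∀ (x : B.endAlgebra) (y : B.rationalTateModule ℓ),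
      c.symm ((rationalTateAction B ℓ x : Module.End ℚ_[ℓ] (B.rationalTateModule ℓ)) y) =
        Matrix.mulVecLin ((ψ x).map (algebraMap ℚ ℚ_[ℓ])) (c.symm y) := by
    intro x y
    rw [LinearEquiv.symm_apply_eq]
    have hcy := LinearMap.congr_fun (hc x) (c.symm y)
    simp only [LinearMap.comp_apply, LinearEquiv.coe_coe, LinearEquiv.apply_symm_apply] at hcy
    exact hcy.symm
  have hj₁x : ∀ (x : B.endAlgebra) (φ : Module.Dual ℚ (ι → ℚ)),
      ((rationalTateAction B ℓ x : Module.End ℚ_[ℓ] (B.rationalTateModule ℓ)).dualMap) (j₁ φ) =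
        j₁ ((Matrix.mulVecLin (ψ x)).dualMap φ) := by
    intro x φ
    refine LinearMap.ext fun y => ?_
    rw [LinearMap.dualMap_apply, hj₁_apply, hj₁_apply, hd0x, LinearMap.dualMap_apply, hc']
  -- (3) `j₀ := 1 ⊗ j₁`, a base change to `ℚ̄_ℓ`
  refine ⟨((TensorProduct.mk ℚ_[ℓ] L (Module.Dual ℚ_[ℓ] (B.rationalTateModule ℓ)) 1).restrictScalars ℚ) ∘ₗ j₁,
    hj₁.comp (TensorProduct.isBaseChange ℚ_[ℓ] (Module.Dual ℚ_[ℓ] (B.rationalTateModule ℓ)) L), fun x φ => ?_⟩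
  change (((rationalTateAction B ℓ x : Module.End ℚ_[ℓ] (B.rationalTateModule ℓ)).dualMap).baseChange L)
      ((1 : L) ⊗ₜ[ℚ_[ℓ]] j₁ φ) = (1 : L) ⊗ₜ[ℚ_[ℓ]] j₁ ((Matrix.mulVecLin (ψ x)).dualMap φ)
  rw [LinearMap.baseChange_tmul, hj₁x]

/-- **The same on the `ε`-blocks, in any injective models**: for `ε ∈ End⁰(B)`, models `V ↪ (ℚ^ι)^∨` of `range ᵗ(ψ ε)` and
`Wε ↪ ℚ̄_ℓ ⊗ (V_ℓ B)^∨` of `range ((ᵗV_ℓ ε) ⊗ 1)`, there is a `ℚ`-linear `jε : V → Wε` over `j₀` which is again a base change to `ℚ̄_ℓ`;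
intertwined block actions stay intertwined. [cite: Lang1982AbelianFunctions, Ch. VII §2, Thm. 2.1, p. 116] [cite: BourbakiAlgebraI1989, Ch. II §5 no. 1 Proposition 4 (p0379)] -/
theorem exists_isBaseChange_dualTateComparison_block {ι : Type} [Fintype ι] [DecidableEq ι]
    (ψ : B.endAlgebra →ₐ[ℚ] Matrix ι ι ℚ) (c : (ι → ℚ_[ℓ]) ≃ₗ[ℚ_[ℓ]] B.rationalTateModule ℓ)
    (hc : ∀ x : B.endAlgebra,
      (c : (ι → ℚ_[ℓ]) →ₗ[ℚ_[ℓ]] B.rationalTateModule ℓ) ∘ₗ Matrix.mulVecLin ((ψ x).map (algebraMap ℚ ℚ_[ℓ])) =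
        (rationalTateAction B ℓ x : Module.End ℚ_[ℓ] (B.rationalTateModule ℓ)) ∘ₗ
          (c : (ι → ℚ_[ℓ]) →ₗ[ℚ_[ℓ]] B.rationalTateModule ℓ))
    (ε : B.endAlgebra)
    {V : Type} [AddCommGroup V] [Module ℚ V] (iV : V →ₗ[ℚ] Module.Dual ℚ (ι → ℚ)) (hiV : Injective iV)
    (hV : LinearMap.range iV = LinearMap.range (Matrix.mulVecLin (ψ ε)).dualMap)
    {Wε : Type} [AddCommGroup Wε] [Module (AlgebraicClosure ℚ_[ℓ]) Wε] [Module ℚ Wε]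
    [IsScalarTower ℚ (AlgebraicClosure ℚ_[ℓ]) Wε]
    (iW : Wε →ₗ[AlgebraicClosure ℚ_[ℓ]] AlgebraicClosure ℚ_[ℓ] ⊗[ℚ_[ℓ]] Module.Dual ℚ_[ℓ] (B.rationalTateModule ℓ))
    (hiW : Injective iW)
    (hW : LinearMap.range iW =
      LinearMap.range (((rationalTateAction B ℓ ε : Module.End ℚ_[ℓ] (B.rationalTateModule ℓ)).dualMap).baseChange
        (AlgebraicClosure ℚ_[ℓ]))) :
    ∃ (j₀ : Module.Dual ℚ (ι → ℚ) →ₗ[ℚ] AlgebraicClosure ℚ_[ℓ] ⊗[ℚ_[ℓ]] Module.Dual ℚ_[ℓ] (B.rationalTateModule ℓ))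
      (jε : V →ₗ[ℚ] Wε),
      IsBaseChange (AlgebraicClosure ℚ_[ℓ]) j₀ ∧ IsBaseChange (AlgebraicClosure ℚ_[ℓ]) jε ∧
      (∀ v, iW (jε v) = j₀ (iV v)) ∧
      ∀ (x : B.endAlgebra) (φ : Module.Dual ℚ (ι → ℚ)),
        (((rationalTateAction B ℓ x : Module.End ℚ_[ℓ] (B.rationalTateModule ℓ)).dualMap).baseChange (AlgebraicClosure ℚ_[ℓ])) (j₀ φ) =
          j₀ ((Matrix.mulVecLin (ψ x)).dualMap φ) := by
  obtain ⟨j₀, hj₀, hj₀x⟩ := exists_isBaseChange_dualTateComparison B ℓ ψ c hc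
  obtain ⟨jε, hjε, hbε⟩ := exists_isBaseChange_block hj₀ iV hiV iW hiW (Matrix.mulVecLin (ψ ε)).dualMap
    (((rationalTateAction B ℓ ε : Module.End ℚ_[ℓ] (B.rationalTateModule ℓ)).dualMap).baseChange (AlgebraicClosure ℚ_[ℓ]))
    (fun φ => hj₀x ε φ) hV hW
  exact ⟨j₀, jε, hj₀, hbε, hjε, hj₀x⟩

end Literature.AlgebraicGeometry.ComplexMultiplication
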